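import Summits.BirchSwinnertonDyer.Rank1Residual.GaloisImage.KolyvaginDerivativeDescent
import Literature.NumberTheory.GaloisRepresentations.ContinuousCohomologyConnecting
import HarnessLib

/-!
# (C3) mechanism, kernel lemma (C): descent of a reduced class with a CORRECTION cocycle — if the
# descent obstruction is a coboundary, `κ|_D` lifts to `H¹(D, T)`
# (cell `bsd-addord`, seat bsd-addord-w2-acc5 gen 0; crux `KatoKuriharaPortThreeShared` =
# stmt-BirchSwinnertonDyer-19560, residual input (C3) = THEOREM D's `hbad`; `--supports 19560`)

## Why (memo HOME/acc5/ACC5-C3-MECHANISM-g0.md §1, Lemma C)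

THEOREM D needs, at a bad place `w ∤ 3r`, `res_D κ_r ∈ red_*(H¹(D, T₃E))` (`D = G_{ℚ_w}`, `red : T → E[M]`),
where `κ_r` is the descended derivative class: `res_{U_r} κ_r = red_*(X̃)`, `X̃ = D_r c_r ∈ H¹(U_r, T)`.
Over `N = D ∩ U_r` (open, normal in `D`, `T^N = 0`) one has, at COCHAIN level, for every `g ∈ D`:
`g⋆x̃ − x̃ − ∂(k̃ g) = M·ỹ_g` (`k̃ g` a lift of `κ(g)`, `ỹ_g` a cocycle on `N` — the descent-obstruction
cocycle, globally `((g − 1)X̃)/M`).  LEMMA C: **if `g ↦ [ỹ_g]` is the coboundary of a class `[t] ∈ H¹(N,T)`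
(`ỹ_g = g⋆t − t + ∂(a_g)`), then `res_D κ ∈ red_*(H¹(D,T))`** — with NO `H²`: the cocycle `x̃ − M·t` has
`D`-invariant class, n1011's descent F4 (`Derivative.existsUnique_resSubgroup_eq_of_forall_conjMap_eq`,
Serre I §2.6 (b)) run with the EXPLICIT witnesses `m_g = k̃ g + M·a_g` produces a cocycle `Φ` on `D`
with `Φ(g) = m_g`, and `red ∘ Φ = κ` on the nose since `M` kills `E[M]`.  (The class-level shortcut
— descend `[x̃ − M t]` by F4 and compare restrictions — does NOT suffice: `res_N` is not injective on
`H¹(D, E[M])`, the ambiguity `inf H¹(D/N, E[M]^N)` is exactly what the value `Φ(g) = k̃ g + M a_g` pins.)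
The memo's §2–§4 (universal norms + p466719 + p467450) supply the coboundary hypothesis at every
anomalous bad `w`; this file is the abstract descent step, for ANY topological group `G`, open normal
`N`, representations `X → X'` and scalar `M` killing `X'`.

* `exists_oneCocycle_apply_eq_of_conj_sub_eq` — F4 WITH EXPLICIT WITNESSES: for a cocycle `φ` on `N`
  and `m : G → X` with `g⋆φ − φ = ∂(m g)` for all `g` (and `X^N = 0`), a cocycle `Φ` on `G` with
  `Φ g = m g` for all `g` and `res [Φ] = [φ]` (the proof is n1011-p11's, verbatim, minus the choice);
* **`exists_cohomologyMap_eq_oneCocycleClass_of_correction`** — LEMMA C at cochain level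
  (hypotheses `hkl`, `hy`, `hcob` as displayed identities);
* `exists_cohomologyMap_eq_oneCocycleClass_of_conjMap_sub` — the same with the coboundary hypothesis
  at CLASS level in `H¹(N, X)`: `[ỹ_g] = g·[t] − [t]`.

HONEST LIMITS: a TOOL lemma (curve-free, `p`-free); closes nothing; the Mackey/universal-norm step
(memo §2–§3) and THEOREM D's re-assembly without `hbad` are not here; nothing is booked.
References: J.-P. Serre, *Galois Cohomology* (1997), I §2.6 (b); K. Rubin, *Euler Systems* (2000)
§4.6 (not held); B. Mazur, K. Rubin, Mem. AMS 799 (2004), App. A, Prop. A.2.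
-/

noncomputable section

set_option linter.dupNamespace false

open CategoryTheory Function Topology Filter
open Literature.NumberTheory.GaloisRepresentations
open Literature.NumberTheory.EllipticCurves (subgroupConj subgroupConj_apply_coe)
open Summit.BirchSwinnertonDyer.Rank1Residual.GaloisImage

universe u v

namespace Summit.BirchSwinnertonDyer.BirchSwinnertonDyer.Theorems.KimAtThreePortSharedC3

variable {R : Type u} [CommRing R] [TopologicalSpace R]
variable {G : Type v} [Group G] [TopologicalSpace G] [IsTopologicalGroup G]
variable (X : TopRep.{v} R G) (N : Subgroup G) [N.Normal]

/-- **Descent with explicit witnesses** (n1011 F4 `Derivative.existsUnique_resSubgroup_eq_of_forall_conjMap_eq`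
with the elements `m_g` GIVEN rather than chosen): for an open normal subgroup `N` with `X^N = 0`, a
continuous cocycle `φ` on `N` and `m : G → X` with `g • φ(g⁻¹ n g) − φ(n) = n • m_g − m_g` for all
`g ∈ G`, `n ∈ N`, there is a continuous cocycle `Φ` on `G` with `Φ(g) = m_g` for EVERY `g` and
`res [Φ] = [φ]`.  Proof = F4's (uniqueness of `m_g` from `X^N = 0`, crossed-homomorphism identity,
continuity at `1` from `Φ|_N = φ`). [cite: SerreGaloisCohomology1997, I §2.6 (b)] -/
theorem exists_oneCocycle_apply_eq_of_conj_sub_eq (hN : IsOpen (N : Set G))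
    (h0 : ∀ v : X, (∀ n : N, X.ρ (n : G) v = v) → v = 0)
    (φ : contOneCocycles (subgroupRep X N)) (m : G → X)
    (hm : ∀ (g : G) (n : N), X.ρ g (φ.1 (subgroupConj N g n)) - φ.1 n = X.ρ (n : G) (m g) - m g) :
    ∃ Φ : contOneCocycles X, (∀ g : G, Φ.1 g = m g) ∧
      resSubgroup X N 1 (oneCocycleClass X Φ) = oneCocycleClass _ φ := by
  have huniq : ∀ g (v : X), (∀ n : N, X.ρ g (φ.1 (subgroupConj N g n)) - φ.1 n = X.ρ (n : G) v - v) →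
      v = m g := fun g v hv =>
    Derivative.eq_of_forall_rho_sub_eq X N h0 fun n => by rw [← hv n, hm g n]
  -- `m` extends `φ`
  have hmN : ∀ n₀ : N, m n₀ = φ.1 n₀ := fun n₀ =>
    (huniq n₀ (φ.1 n₀) fun n => Derivative.conj_sub_eq_of_mem X N φ n₀ n).symm
  -- `m` is a crossed homomorphism
  have hmul : ∀ g h : G, m (g * h) = m g + X.ρ g (m h) := by
    intro g h
    refine (huniq (g * h) _ fun n => ?_).symm
    have hconj : subgroupConj N (g * h) n = subgroupConj N h (subgroupConj N g n) :=
      Subtype.ext (by simp only [subgroupConj_apply_coe, mul_inv_rev, mul_assoc])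
    have hh := hm h (subgroupConj N g n)
    rw [sub_eq_iff_eq_add] at hh
    have hg := hm g n
    rw [sub_eq_iff_eq_add] at hg
    rw [hconj, ρ_mul_apply, hh, map_add, hg, map_sub, subgroupConj_apply_coe, ← ρ_mul_apply,
      show g * (g⁻¹ * ↑n * g) = ↑n * g by group, ρ_mul_apply]
    simp only [map_add]
    abel
  -- continuity: on `N` the map is `φ`, and a crossed homomorphism continuous at `1` is continuous
  have hcontN : ContinuousOn m (N : Set G) := by
    rw [continuousOn_iff_continuous_restrict]
    have : (N : Set G).restrict m = fun n : N => φ.1 n := funext fun n => hmN n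
    rw [this]
    exact φ.1.continuous
  have hcont1 : ContinuousAt m 1 := hcontN.continuousAt (hN.mem_nhds N.one_mem)
  have hcont : Continuous m := by
    rw [continuous_iff_continuousAt]
    intro g₀
    have heq : m = fun x => m g₀ + X.ρ g₀ (m (g₀⁻¹ * x)) := funext fun x => by
      rw [← hmul, mul_inv_cancel_left]
    rw [heq]
    refine continuousAt_const.add ((X.ρ g₀).continuous.continuousAt.comp ?_)
    have h1 : ContinuousAt m (g₀⁻¹ * g₀) := by rw [inv_mul_cancel]; exact hcont1
    exact h1.comp (continuous_const.mul continuous_id).continuousAt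
  -- the global cocycle and its restriction
  let Φ : contOneCocycles X := ⟨⟨m, hcont⟩, fun g h => hmul g h⟩
  refine ⟨Φ, fun g => rfl, ?_⟩
  rw [resSubgroup_oneCocycleClass]
  exact congrArg _ (Subtype.ext (ContinuousMap.ext fun n => hmN n))

variable (X' : TopRep.{v} R G)

/-- **LEMMA C — descent of a reduced class with a correction cocycle** (memo §1).  Data: a morphism
`red : X ⟶ X'` and a scalar `M` killing `X'`; a cocycle `k` on `G` with values in `X'` (the class to
be lifted) and lifts `kl g ∈ X` of its values; cocycles `x`, `t` on the open normal subgroup `N`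
(`X^N = 0`) and, for every `g ∈ G`, a cocycle `y g` on `N` and an element `a g ∈ X` with the two
displayed identities: (`hy`) `g⋆x − x − ∂(kl g) = M·(y g)` — the descent-obstruction cocycle — and
(`hcob`) `y g = g⋆t − t + ∂(a g)` — it is the coboundary of `t`.  Then the class of `k` is `red_*`
of a class of `H¹(G, X)`: namely of the cocycle `Φ` with `Φ(g) = kl g + M·a g` descending `x − M·t`
(`exists_oneCocycle_apply_eq_of_conj_sub_eq`), and `red ∘ Φ = k` because `M·X' = 0`.  (That
`k|_N = red ∘ x` is implied by the hypotheses at `g ∈ N`.)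
[cite: MazurRubin2004, App. A Prop. A.2 (the local condition of [Ru6] Thm. 4.5.1 at the primes of Σ)] -/
theorem exists_cohomologyMap_eq_oneCocycleClass_of_correction (hN : IsOpen (N : Set G))
    (h0 : ∀ v : X, (∀ n : N, X.ρ (n : G) v = v) → v = 0)
    (red : X ⟶ X') (M : R) (hM' : ∀ v : X', M • v = 0)
    (k : contOneCocycles X') (kl : G → X) (hkl : ∀ g : G, red.hom (kl g) = k.1 g)
    (x t : contOneCocycles (subgroupRep X N)) (y : G → contOneCocycles (subgroupRep X N)) (a : G → X)
    (hy : ∀ (g : G) (n : N), X.ρ g (x.1 (subgroupConj N g n)) - x.1 n -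
      (X.ρ (n : G) (kl g) - kl g) = M • (y g).1 n)
    (hcob : ∀ (g : G) (n : N), (y g).1 n = X.ρ g (t.1 (subgroupConj N g n)) - t.1 n +
      (X.ρ (n : G) (a g) - a g)) :
    ∃ z : continuousCohomology 1 X, cohomologyMap red 1 z = oneCocycleClass X' k := by
  -- the corrected cocycle `φ = x − M t` and the witnesses `m g = kl g + M a g`
  set φ : contOneCocycles (subgroupRep X N) := x - M • t with hφ
  have hmφ : ∀ (g : G) (n : N), X.ρ g (φ.1 (subgroupConj N g n)) - φ.1 n =
      X.ρ (n : G) (kl g + M • a g) - (kl g + M • a g) := by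
    intro g n
    have e1 : φ.1 (subgroupConj N g n) = x.1 (subgroupConj N g n) - M • t.1 (subgroupConj N g n) := rfl
    have e2 : φ.1 n = x.1 n - M • t.1 n := rfl
    have hy' := hy g n
    rw [hcob g n] at hy'
    -- solve `hy'` for `g • x(g⁻¹ n g)`
    have key : X.ρ g (x.1 (subgroupConj N g n)) = x.1 n +
        ((X.ρ (n : G) (kl g) - kl g) + M • (X.ρ g (t.1 (subgroupConj N g n)) - t.1 n +
          (X.ρ (n : G) (a g) - a g))) := by
      rw [← hy']; abel
    rw [e1, e2, map_sub, map_smul, map_add, map_smul, key, smul_add, smul_sub, smul_sub]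
    abel
  obtain ⟨Φ, hΦm, -⟩ :=
    exists_oneCocycle_apply_eq_of_conj_sub_eq X N hN h0 φ (fun g => kl g + M • a g) hmφ
  refine ⟨oneCocycleClass X Φ, ?_⟩
  rw [cohomologyMap_oneCocycleClass]
  congr 1
  refine Subtype.ext (ContinuousMap.ext fun g => ?_)
  rw [pullback_id_resIdHom_apply, hΦm g]
  simp only [map_add, map_smul, hkl g, hM', add_zero]

/-- The cocycle `g⋆t − t` on `N` (`n ↦ g • t(g⁻¹ n g) − t(n)`), whose class is `g·[t] − [t]`. [folklore] -/
theorem conjMap_sub_eq_oneCocycleClass (g : G) (t : contOneCocycles (subgroupRep X N)) :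
    conjMap X N g 1 (oneCocycleClass _ t) - oneCocycleClass _ t =
      oneCocycleClass _ (contOneCocycles.pullback (subgroupConj N g) (conjRepHom X N g) t - t) := by
  rw [conjMap_oneCocycleClass, oneCocycleClass_sub]

/-- **LEMMA C with the coboundary hypothesis at CLASS level**: as
`exists_cohomologyMap_eq_oneCocycleClass_of_correction`, but assuming only
`[y g] = g·[t] − [t]` in `H¹(N, X)` for every `g` (the elements `a g` are then produced by
`oneCocycleClass_eq_zero_iff`).  This is the form the memo's §2–§4 deliver: the obstruction cocycle
`g ↦ [ỹ_g]` takes values in `H¹_ur(N, T)` where every cocycle of the cyclic quotient is a coboundary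
(p466719). [cite: MazurRubin2004, App. A Prop. A.2 (the local condition of [Ru6] Thm. 4.5.1 at the primes of Σ)] -/
theorem exists_cohomologyMap_eq_oneCocycleClass_of_conjMap_sub (hN : IsOpen (N : Set G))
    (h0 : ∀ v : X, (∀ n : N, X.ρ (n : G) v = v) → v = 0)
    (red : X ⟶ X') (M : R) (hM' : ∀ v : X', M • v = 0)
    (k : contOneCocycles X') (kl : G → X) (hkl : ∀ g : G, red.hom (kl g) = k.1 g)
    (x t : contOneCocycles (subgroupRep X N)) (y : G → contOneCocycles (subgroupRep X N))
    (hy : ∀ (g : G) (n : N), X.ρ g (x.1 (subgroupConj N g n)) - x.1 n -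
      (X.ρ (n : G) (kl g) - kl g) = M • (y g).1 n)
    (hcob : ∀ g : G, oneCocycleClass _ (y g) =
      conjMap X N g 1 (oneCocycleClass _ t) - oneCocycleClass _ t) :
    ∃ z : continuousCohomology 1 X, cohomologyMap red 1 z = oneCocycleClass X' k := by
  have ha : ∀ g : G, ∃ a : X, ∀ n : N, (y g).1 n = X.ρ g (t.1 (subgroupConj N g n)) - t.1 n +
      (X.ρ (n : G) a - a) := by
    intro g
    have h := hcob g
    rw [conjMap_sub_eq_oneCocycleClass, ← sub_eq_zero, ← oneCocycleClass_sub,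
      oneCocycleClass_eq_zero_iff] at h
    obtain ⟨a, ha⟩ := h
    refine ⟨a, fun n => ?_⟩
    have han := ha n
    -- unfold the difference cocycle at `n`
    have e : (y g - (contOneCocycles.pullback (subgroupConj N g) (conjRepHom X N g) t - t)).1 n =
        (y g).1 n - (X.ρ g (t.1 (subgroupConj N g n)) - t.1 n) := rfl
    rw [e] at han
    rw [← sub_eq_iff_eq_add', han]
    rfl
  choose a ha using ha
  exact exists_cohomologyMap_eq_oneCocycleClass_of_correction X N X' hN h0 red M hM' k kl hkl x t y a
    hy ha

end Summit.BirchSwinnertonDyer.BirchSwinnertonDyer.Theorems.KimAtThreePortSharedC3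

end
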